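import Summits.Schanuel.Schanuel.Theorems.ZilberEacGraphSurfaceLogRoot
import HarnessLib

/-!
# Non-split surfaces over a graph base, III-b: the sequence of logarithmically corrected roots

HONEST FRAMING.  Cell `pub-schanuel` (Zilber's Exponential-Algebraic Closedness, case ladder;
host summit Schanuel), seat 2, gen 17.  Bookkeeping for engine v3 (`ZilberEacGraphSurfaceEscapeLog`):
the sequence of exact roots `z₀(j)`, `L(j)` of `e^{R(z₀)} = θ e^{μ L}`, `e^{L} = z₀`, along a root
direction, with all the size facts the engine uses (`exists_alRoot_log_seq`); two small real
estimates; `u ↦ Q(θ e^{u})` is not identically zero.  NOT Schanuel's conjecture (neither used nor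
implied; EAC ⇏ SC); `EC(3,2)` stays OPEN; Mantova–Masser's density question (PLMS 2024, §1 p. 5)
stays OPEN in general.
-/

noncomputable section

open Filter Topology Metric Set Complex Polynomial
open Literature.ModelTheory.Zilber

set_option linter.dupNamespace false

namespace Summit.Schanuel.Schanuel.Theorems

/-! ## Part A. Two small real estimates -/

/-- `e^{c log y} ≤ Yᴺ` for `c ≤ N`, `1 ≤ y ≤ Y`. [folklore] -/
theorem exp_mul_log_le_pow {c y Y : ℝ} {N : ℕ} (hcN : c ≤ N) (hy : 1 ≤ y)
    (hyY : y ≤ Y) : Real.exp (c * Real.log y) ≤ Y ^ N := by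
  have hYpos : 0 < Y := by linarith
  have hlogy : 0 ≤ Real.log y := Real.log_nonneg hy
  have hlogY : Real.log y ≤ Real.log Y := Real.log_le_log (by linarith) hyY
  calc Real.exp (c * Real.log y) ≤ Real.exp ((N : ℝ) * Real.log Y) := by
        refine Real.exp_le_exp.2 ?_
        calc c * Real.log y ≤ (N : ℝ) * Real.log y := mul_le_mul_of_nonneg_right hcN hlogy
          _ ≤ (N : ℝ) * Real.log Y := mul_le_mul_of_nonneg_left hlogY (Nat.cast_nonneg N)
    _ = Y ^ N := by rw [Real.exp_nat_mul, Real.exp_log hYpos]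

/-- If `e^{L} = z₀` then `Re L = log ‖z₀‖`. [folklore] -/
theorem re_eq_log_norm_of_exp_eq {L z₀ : ℂ} (h : exp L = z₀) : L.re = Real.log ‖z₀‖ := by
  rw [← h, Complex.norm_exp, Real.log_exp]


/-- **The logarithmic window along the local coordinate**: if `Re R(z₀) = log θ' + μ ℓ₀`,
`R(z) = R(z₀) + u + ρ` with `‖u‖, ‖ρ‖ ≤ 1` and `|ℓ - ℓ₀| ≤ 1/8`, then
`|Re R(z) - μ ℓ| ≤ |log θ'| + 2 + |μ|/8`. [folklore] -/
theorem abs_re_sub_mul_log_le_window {Rz Rz₀ u ρ : ℂ} {θn lz lz₀ μ : ℝ}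
    (hRz : Rz = Rz₀ + u + ρ) (hre : Rz₀.re = Real.log θn + μ * lz₀) (hu : ‖u‖ ≤ 1)
    (hρ : ‖ρ‖ ≤ 1) (hl : |lz - lz₀| ≤ 1 / 8) :
    |Rz.re - μ * lz| ≤ |Real.log θn| + 2 + |μ| / 8 := by
  rw [hRz, Complex.add_re, Complex.add_re, hre]
  have e1 : Real.log θn + μ * lz₀ + u.re + ρ.re - μ * lz =
      Real.log θn + (u.re + ρ.re) + μ * (lz₀ - lz) := by ring
  rw [e1]
  have h1 := abs_re_le_norm u
  have h2 := abs_re_le_norm ρ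
  have h3 := abs_add_le (Real.log θn + (u.re + ρ.re)) (μ * (lz₀ - lz))
  have h4 := abs_add_le (Real.log θn) (u.re + ρ.re)
  have h5 := abs_add_le u.re ρ.re
  have h6 : |μ * (lz₀ - lz)| ≤ |μ| / 8 := by
    rw [abs_mul, abs_sub_comm]
    calc |μ| * |lz - lz₀| ≤ |μ| * (1 / 8) := mul_le_mul_of_nonneg_left hl (abs_nonneg _)
      _ = |μ| / 8 := by ring
  linarith

/-! ## Part B. The limit function is not zero; the corrected roots -/

/-- `u ↦ Q(θ e^{u})` is not identically zero for `Q ≠ 0`, `θ ≠ 0` (else `Q` vanishes on the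
infinite set `θ e^{ℝ}`). [folklore] -/
theorem exists_eval_mul_exp_ne_zero {Q : Polynomial ℂ} (hQ : Q ≠ 0) {θ : ℂ} (hθ0 : θ ≠ 0) :
    ∃ u : ℂ, Q.eval (θ * exp u) ≠ 0 := by
  by_contra hall
  push Not at hall
  have hinf : Set.Infinite {x : ℂ | Q.IsRoot x} := by
    have hinj : Function.Injective (fun t : ℝ => θ * exp (t : ℂ)) := by
      intro t₁ t₂ ht
      have h1 : exp (t₁ : ℂ) = exp (t₂ : ℂ) := mul_left_cancel₀ hθ0 ht
      have h2 : Real.exp t₁ = Real.exp t₂ := by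
        have := congrArg norm h1
        rwa [Complex.norm_exp, Complex.norm_exp, Complex.ofReal_re, Complex.ofReal_re] at this
      exact Real.exp_injective h2
    have hsub : Set.range (fun t : ℝ => θ * exp (t : ℂ)) ⊆ {x : ℂ | Q.IsRoot x} := by
      rintro _ ⟨t, rfl⟩
      exact hall t
    exact (Set.infinite_range_of_injective hinj).mono hsub
  exact hQ (Polynomial.eq_zero_of_infinite_isRoot Q hinf)

/-- **The sequence of corrected roots.**  `deg R ≥ 2`, `θ ≠ 0`, `μ ∈ ℝ`: there are stage sizes
`Λ_j → ∞` and exact roots `z₀(j)` with logarithms `L(j)` (`e^{L(j)} = z₀(j)`) of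
`e^{R(z₀)} = θ e^{μ L}` — indeed `R(z₀(j)) = 2πi N_j + log θ + μ L(j)` — with
`Re R(z₀) = log ‖θ‖ + μ log ‖z₀‖`, `‖z₀‖ ≥ 16`, `‖a‖‖z₀‖ ≥ 2`, `Re z₀ ≤ -(3/16)Λ_j`, `‖z₀‖ ≤ 3Λ_j`,
`Re z₀ + 1 ≤ 0` (root direction `exists_rootDirection`; stages `exists_alRoot_log`). (new) -/
theorem exists_alRoot_log_seq (R : Polynomial ℂ) (hd : 2 ≤ R.natDegree) {θ : ℂ} (hθ0 : θ ≠ 0)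
    (μ : ℝ) :
    ∃ (Λ : ℕ → ℝ) (z₀ Lg : ℕ → ℂ), Tendsto Λ atTop atTop ∧ ∀ j,
      exp (Lg j) = z₀ j ∧ exp (R.eval (z₀ j)) = θ * exp ((μ : ℂ) * Lg j) ∧
      (R.eval (z₀ j)).re = Real.log ‖θ‖ + μ * Real.log ‖z₀ j‖ ∧
      1 ≤ ‖z₀ j‖ ∧ 2 ≤ ‖R.leadingCoeff‖ * ‖z₀ j‖ ∧ (z₀ j).re ≤ -(3 / 16) * Λ j ∧
      ‖z₀ j‖ ≤ 3 * Λ j ∧ (z₀ j).re + 1 ≤ 0 ∧ 16 ≤ ‖z₀ j‖ := by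
  set d : ℕ := R.natDegree with hd_def
  set a : ℂ := R.leadingCoeff with ha_def
  set ℓ : Polynomial ℂ := R.eraseLead with hℓ_def
  have hR0 : R ≠ 0 := by
    rintro rfl
    rw [hd_def, Polynomial.natDegree_zero] at hd
    omega
  have ha0 : a ≠ 0 := Polynomial.leadingCoeff_ne_zero.2 hR0
  have hapos : 0 < ‖a‖ := norm_pos_iff.2 ha0
  set c₀ : ℂ := Complex.log θ with hc₀_def
  have hc₀ : exp c₀ = θ := Complex.exp_log hθ0
  -- a root direction
  obtain ⟨ω, s, hs, hω, hre⟩ := exists_rootDirection a ha0 d hd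
  have hrhs : (2 * Real.pi * I * s : ℂ) ≠ 0 := by
    have hsC : (s : ℂ) ≠ 0 := by rcases hs with rfl | rfl <;> simp
    have hπ : (Real.pi : ℂ) ≠ 0 := Complex.ofReal_ne_zero.mpr Real.pi_pos.ne'
    simp [hsC, hπ, Complex.I_ne_zero]
  have hω0 : ω ≠ 0 := by
    rintro rfl
    rw [zero_pow (by omega), mul_zero] at hω
    exact hrhs hω.symm
  have hωpos : 0 < ‖ω‖ := norm_pos_iff.mpr hω0
  -- stage sizes and eventual conditions
  set Λ : ℕ → ℝ := fun k => ((k : ℝ) + 1) * ‖ω‖ with hΛ_def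
  have hΛ : Tendsto Λ atTop atTop := (tendsto_natCast_add_atTop 1).atTop_mul_const hωpos
  set C₁ : ℝ := coeffNormSum ℓ * (3 * ‖ω‖ + 1) ^ (d - 1) + ‖c₀‖ with hC₁
  have hev₁ := eventually_alRoot_log_hyp C₁ μ hωpos
  have hev₂ : ∀ᶠ k : ℕ in atTop, 3 ≤ Λ k := hΛ.eventually_ge_atTop 3
  have hev₃ : ∀ᶠ k : ℕ in atTop, 6 ≤ ‖a‖ * Λ k := (hΛ.const_mul_atTop hapos).eventually_ge_atTop 6
  have hev₄ : ∀ᶠ k : ℕ in atTop, 48 ≤ Λ k := hΛ.eventually_ge_atTop 48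
  obtain ⟨K₀, hK₀⟩ := eventually_atTop.1 (hev₁.and (hev₂.and (hev₃.and hev₄)))
  -- the corrected roots `z₀(j)` with logarithms `L(j)` at stage `j + K₀`
  have hroot : ∀ j : ℕ, ∃ z₀ Lg : ℂ, exp Lg = z₀ ∧
      exp (R.eval z₀) = θ * exp ((μ : ℂ) * Lg) ∧
      (R.eval z₀).re = Real.log ‖θ‖ + μ * Real.log ‖z₀‖ ∧
      1 ≤ ‖z₀‖ ∧ 2 ≤ ‖a‖ * ‖z₀‖ ∧ z₀.re ≤ -(3 / 16) * Λ (j + K₀) ∧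
      ‖z₀‖ ≤ 3 * Λ (j + K₀) ∧ z₀.re + 1 ≤ 0 ∧ 16 ≤ ‖z₀‖ := by
    intro j
    obtain ⟨⟨h1a, h1b⟩, h2, h3, h4⟩ := hK₀ (j + K₀) (Nat.le_add_left _ _)
    obtain ⟨z₀, Lg, hLz, hz₀, hup, hlow, hre₀⟩ :=
      exists_alRoot_log R hd ω s hs hω hre μ c₀ (j + K₀) h1a (by rw [hC₁] at h1b; exact h1b)
    have hΛk : Λ (j + K₀) = (((j + K₀ : ℕ) : ℝ) + 1) * ‖ω‖ := rfl
    have hReL : Lg.re = Real.log ‖z₀‖ := re_eq_log_norm_of_exp_eq hLz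
    refine ⟨z₀, Lg, hLz, ?_, ?_, ?_, ?_, ?_, ?_, ?_, ?_⟩
    · rw [hz₀, Complex.exp_add, Complex.exp_add, Complex.exp_int_mul_two_pi_mul_I, one_mul, hc₀]
    · rw [hz₀, Complex.add_re, Complex.add_re, gce_re_intCast_mul_two_pi_I, zero_add, hc₀_def,
        Complex.log_re, Complex.re_ofReal_mul, hReL]
    · rw [hΛk] at h2; linarith
    · rw [hΛk] at h3; nlinarith [mul_le_mul_of_nonneg_left hlow hapos.le]
    · rw [hΛk]; linarith
    · rw [hΛk]; linarith
    · rw [hΛk] at h4; linarith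
    · rw [hΛk] at h4; linarith
  choose z₀ Lg hroot using hroot
  refine ⟨fun j => Λ (j + K₀), z₀, Lg, hΛ.comp (tendsto_add_atTop_nat K₀), fun j => ?_⟩
  exact hroot j

end Summit.Schanuel.Schanuel.Theorems
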